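import Summits.AtomisticToContinuum.HydrodynamicLimit.Theorems.MourreKoopmanChargesLinearToEntropyInBandVisCoreNToolkit
import Mathlib.Analysis.Calculus.MeanValue
import Mathlib.Analysis.InnerProductSpace.Calculus
import Mathlib.Analysis.Normed.Module.Convex
import HarnessLib

/-!
# Route `MourreKoopmanCharges`, crux `LinearToEntropyInBand` (stmt-AtomisticToContinuum-17740), skeleton v8:
# stub 4a-ii, the second-order Taylor bound of the tested capped Euler flux (plan § 1 (3) D1, the `Quad` term)

Support file (`--supports stmt-AtomisticToContinuum-17740`; registered helper `stub_windowClauseQuadRemainder`; worker of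
lead prover-line-…-17740-c6-0, wave 1; plan `WINDOWCLAUSE-PLAN.md` § 1 (3) D1).  The block Euler remainder of the 4a-ii
chain contains `Quad = (N+1) ∫ ∇λ_s : [F̂(Ū_vis) − F(U_s) − DF(U_s)(Ū_vis − U_s)] dx`, where `F̂` is the CAPPED tested Euler
flux of the visible block fields — the integrand of `visFluxDensityN` (DefsB (e) / toolkit A § 0), a STATE FUNCTION of the
block variables `U = (ρ̄, m̄, ē)` with parameters the test vectors `(A₀(x), A₄(x), A_j(x))`, the cap density `ρ_s(x)` and
`σ` (`visFluxDensityN_eq_testedFlux`, `rfl`).  It is priced by MBLD (i) once it is bounded by `Cq (|δρ̄|² + ‖δm̄‖² + |δē|²)`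
with ONE constant `Cq` for all `(x, s)` — the content of this file:

* § 1 (abstract) `norm_sub_sub_le_of_norm_fderiv_sub_le`: `‖f y − f x − f′(x)(y − x)‖ ≤ C ‖y − x‖²` on a convex set from
  `‖f′ y − f′ x‖ ≤ C ‖y − x‖` (mean value inequality for `z ↦ f z − f′(x) z` on the segment);
  `exists_abs_taylor₂_le_of_contDiffOn`: for `Φ : P × E → ℝ` of class `C²` on an open `O ⊇ K`, `K` compact, ONE `M ≥ 0` with
  `|Φ(p, y) − Φ(p, x) − D₂Φ(p, x)(y − x)| ≤ M ‖y − x‖²` whenever `{p} × [x, y] ⊆ K` (`M = sup_K ‖D²Φ‖`; the parameters ride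
  as frozen coordinates, so uniformity in them is compactness, not a computation).
* § 2 `contDiffAt_testedFlux`: the uncapped tested flux is `C²` in `((a₀, a₄, a), U)` wherever `0 < ρ`, `ρσ³ < η₁`, given
  `Z = hsCompressibility ∈ C²((0, η₁))` (dischargeable from the EOS window: `Z = 1 + ηF′`, `F` analytic);
  `abs_testedFlux_taylor₂_le`: for `‖a₀‖, ‖a₄‖, ‖a_j‖ ≤ β`, `ρmin ≤ ρs ≤ ρmax`, `‖u‖ ≤ Ub`, `|es| ≤ Eb` and `U` in the box
  `|ρ − ρs| ≤ ρs/2`, `‖m − ρs u‖ ≤ r`, `|e − es| ≤ r` — on which the EOS cap `min ρ̄ (2ρs)` is INACTIVE and `ρ ≥ ρmin/2` — the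
  capped flux `F` is differentiable at `Us = (ρs, ρs u, es)` and `|F U − F Us − DF(Us)(U − Us)| ≤ Cq (|δρ|² + ‖δm‖² + |δe|²)`,
  `Cq = Cq(β, ρmin, ρmax, Ub, Eb, σ, η₁, r, Z) ≥ 0` (strict guard `(3/2) ρmax σ³ < η₁`).  `DF(Us)` is `fderiv`; its closed
  form (the `δF` of `…WindowClauseEulerStructure`) is not computed here.

Nothing here restates the crux, a stub, a neighbour's stub or the Statement; no definitions.  References: H.-T. Yau, Lett.
Math. Phys. 22 (1991) § 2 (the quadratic one-block remainder); C. Kipnis, C. Landim, *Scaling Limits of Interacting Particle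
Systems* (1999) Ch. 6; J. Dieudonné, *Foundations of Modern Analysis* (1960) (8.6.2), (8.14.3).
-/
noncomputable section

open MeasureTheory Filter Set
open scoped ENNReal Topology InnerProductSpace BigOperators

namespace Summit.AtomisticToContinuum.HydrodynamicLimit.Theorems.LTEInBand

open Literature.MathematicalPhysics.KineticTheory Literature.Analysis.FluidPDE Literature.Analysis.FunctionSpaces

/-! ## § 1 Second-order Taylor estimates (abstract) -/

section Abstract

variable {E G P : Type*} [NormedAddCommGroup E] [NormedSpace ℝ E] [NormedAddCommGroup G] [NormedSpace ℝ G]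
  [NormedAddCommGroup P] [NormedSpace ℝ P]

/-- **Second-order estimate from a Lipschitz bound of the derivative at the base point.** If `f` has derivative
`f'` within a convex set `s ∋ x` and `‖f' y − f' x‖ ≤ C ‖y − x‖` on `s`, then
`‖f y − f x − f' x (y − x)‖ ≤ C ‖y − x‖²` on `s` (mean value inequality on the segment `[x, y]` for
`z ↦ f z − f' x z`, whose derivative `f' z − f' x` has norm `≤ C ‖y − x‖` there). -/
theorem norm_sub_sub_le_of_norm_fderiv_sub_le {f : E → G} {f' : E → E →L[ℝ] G} {s : Set E} {x : E} {C : ℝ}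
    (hs : Convex ℝ s) (hx : x ∈ s) (hf : ∀ y ∈ s, HasFDerivWithinAt f (f' y) s y)
    (hC : ∀ y ∈ s, ‖f' y - f' x‖ ≤ C * ‖y - x‖) {y : E} (hy : y ∈ s) :
    ‖f y - f x - f' x (y - x)‖ ≤ C * ‖y - x‖ ^ 2 := by
  -- adapted from `DragDefect.norm_taylor₂_le` (FinalStateConjecture, EIHFluxBalance…DragDefectTaylor)
  have hseg : segment ℝ x y ⊆ s := hs.segment_subset hx hy
  by_cases hyx : y = x
  · subst hyx
    simp
  have hC0 : 0 ≤ C := by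
    have h := hC y hy
    have hpos : 0 < ‖y - x‖ := norm_pos_iff.2 (sub_ne_zero.2 hyx)
    nlinarith [norm_nonneg (f' y - f' x)]
  have hderiv : ∀ z ∈ segment ℝ x y, HasFDerivWithinAt f (f' z) (segment ℝ x y) z :=
    fun z hz => (hf z (hseg hz)).mono hseg
  have hbound : ∀ z ∈ segment ℝ x y, ‖f' z - f' x‖ ≤ C * ‖y - x‖ := fun z hz =>
    (hC z (hseg hz)).trans (mul_le_mul_of_nonneg_left (norm_sub_le_of_mem_segment hz) hC0)
  have h := (convex_segment x y).norm_image_sub_le_of_norm_hasFDerivWithin_le' hderiv hbound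
    (left_mem_segment ℝ x y) (right_mem_segment ℝ x y)
  calc _ ≤ C * ‖y - x‖ * ‖y - x‖ := h
    _ = C * ‖y - x‖ ^ 2 := by ring

-- nested operator spaces `P × E →L (P × E →L ℝ)`
set_option maxSynthPendingDepth 3 in
/-- **Uniform second-order Taylor bound on compact sets, with parameters.** If `Φ : P × E → ℝ` is `C²` on an open
set `O` and `K ⊆ O` is compact, there is `M ≥ 0` such that for every parameter `p` and all `x, y` whose segment
`{p} × [x, y]` lies in `K`, `|Φ(p, y) − Φ(p, x) − D₂Φ(p, x)(y − x)| ≤ M ‖y − x‖²` — `M` a bound of `‖D²Φ‖` on `K`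
(mean value inequality for `DΦ` on `{p} × [x, z]`, then `norm_sub_sub_le_of_norm_fderiv_sub_le` for the slice). -/
theorem exists_abs_taylor₂_le_of_contDiffOn {Φ : P × E → ℝ} {O K : Set (P × E)} (hO : IsOpen O)
    (hΦ : ContDiffOn ℝ 2 Φ O) (hK : IsCompact K) (hKO : K ⊆ O) :
    ∃ M : ℝ, 0 ≤ M ∧ ∀ (p : P) (x y : E), (∀ z ∈ segment ℝ x y, (p, z) ∈ K) →
      |Φ (p, y) - Φ (p, x) - fderiv ℝ (fun z => Φ (p, z)) x (y - x)| ≤ M * ‖y - x‖ ^ 2 := by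
  -- the second derivative is continuous on `O`, hence bounded on `K`
  have hΦ1 : ContDiffOn ℝ 1 (fderiv ℝ Φ) O := hΦ.fderiv_of_isOpen hO (by norm_num)
  have hc2 : ContinuousOn (fderiv ℝ (fderiv ℝ Φ)) O := hΦ1.continuousOn_fderiv_of_isOpen hO le_rfl
  obtain ⟨M, hM⟩ := hK.exists_bound_of_continuousOn (f := fderiv ℝ (fderiv ℝ Φ)) (hc2.mono hKO)
  refine ⟨max M 0, le_max_right _ _, fun p x y hseg => ?_⟩
  have hd1 : ∀ w ∈ O, HasFDerivAt Φ (fderiv ℝ Φ w) w := fun w hw =>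
    ((hΦ.differentiableOn (by norm_num)).differentiableAt (hO.mem_nhds hw)).hasFDerivAt
  have hd2 : ∀ w ∈ O, HasFDerivAt (fderiv ℝ Φ) (fderiv ℝ (fderiv ℝ Φ) w) w := fun w hw =>
    ((hΦ1.differentiableOn (by norm_num)).differentiableAt (hO.mem_nhds hw)).hasFDerivAt
  -- the slice `f = Φ (p, ·)` and its derivative
  set f : E → ℝ := fun z => Φ (p, z) with hf
  set f' : E → E →L[ℝ] ℝ := fun z => (fderiv ℝ Φ (p, z)).comp (ContinuousLinearMap.inr ℝ P E) with hf'
  have hff' : ∀ z, (p, z) ∈ O → HasFDerivAt f (f' z) z := fun z hz =>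
    (hd1 _ hz).comp z (hasFDerivAt_prodMk_right p z)
  have hxK : (p, x) ∈ K := hseg x (left_mem_segment ℝ x y)
  -- Lipschitz bound of `f'` at `x` along the segment (mean value for `fderiv Φ` on `{p} × [x, z]`)
  have hlip : ∀ z ∈ segment ℝ x y, ‖f' z - f' x‖ ≤ max M 0 * ‖z - x‖ := by
    intro z hz
    have hsub : segment ℝ (p, x) (p, z) ⊆ K := by
      rintro w ⟨a, b, ha, hb, hab, rfl⟩
      have hw : a • ((p, x) : P × E) + b • (p, z) = (p, a • x + b • z) := by
        ext
        · simp only [Prod.fst_add, Prod.smul_fst, ← add_smul, hab, one_smul]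
        · simp only [Prod.snd_add, Prod.smul_snd]
      rw [hw]
      exact hseg _ ((convex_segment x y).segment_subset (left_mem_segment ℝ x y) hz ⟨a, b, ha, hb, hab, rfl⟩)
    have hmv := (convex_segment ((p, x) : P × E) (p, z)).norm_image_sub_le_of_norm_hasFDerivWithin_le
      (f := fderiv ℝ Φ) (fun w hw => (hd2 w (hKO (hsub hw))).hasFDerivWithinAt)
      (fun w hw => (hM w (hsub hw)).trans (le_max_left M 0)) (left_mem_segment ℝ _ _) (right_mem_segment ℝ _ _)
    have hnorm : ‖((p, z) : P × E) - (p, x)‖ = ‖z - x‖ := by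
      simp only [Prod.mk_sub_mk, sub_self, Prod.norm_mk, norm_zero, max_eq_right (norm_nonneg _)]
    rw [hnorm] at hmv
    calc ‖f' z - f' x‖ = ‖(fderiv ℝ Φ (p, z) - fderiv ℝ Φ (p, x)).comp (ContinuousLinearMap.inr ℝ P E)‖ := by
          rw [ContinuousLinearMap.sub_comp]
      _ ≤ ‖fderiv ℝ Φ (p, z) - fderiv ℝ Φ (p, x)‖ := by
          refine ContinuousLinearMap.opNorm_le_bound _ (norm_nonneg _) fun v => ?_
          have hv : ‖ContinuousLinearMap.inr ℝ P E v‖ = ‖v‖ := by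
            simp only [ContinuousLinearMap.inr_apply, Prod.norm_mk, norm_zero, max_eq_right (norm_nonneg _)]
          rw [ContinuousLinearMap.comp_apply, ← hv]
          exact (fderiv ℝ Φ (p, z) - fderiv ℝ Φ (p, x)).le_opNorm _
      _ ≤ max M 0 * ‖z - x‖ := hmv
  have hmain := norm_sub_sub_le_of_norm_fderiv_sub_le (convex_segment x y) (left_mem_segment ℝ x y)
    (fun z hz => (hff' z (hKO (hseg z hz))).hasFDerivWithinAt) hlip (right_mem_segment ℝ x y)
  rw [(hff' x (hKO hxK)).fderiv, ← Real.norm_eq_abs]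
  exact hmain

end Abstract

/-! ## § 2 The tested capped Euler flux as a state function -/

section Flux

/-- **The tested Euler flux is `C²` in the block variables and the test vectors** away from the vacuum and inside the
EOS window: the UNCAPPED integrand of `visFluxDensityN` (DefsB (e) / toolkit A), as a function of
`w = ((a₀, a₄, a), (ρ, m, e))`, `F = ⟪a₀, m⟫ + Σⱼ (⟪aⱼ, m⟫ w̄ⱼ + p aⱼⱼ) + ⟪a₄, w̄⟫ (e + p)`, `w̄ = ρ⁻¹ m`,
`p = ρ (2/3)(e/ρ − ‖w̄‖²/2) Z(ρσ³)`, is `C²` at every `w` with `0 < ρ`, `ρσ³ < η₁`, if `Z = hsCompressibility` is `C²`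
on `(0, η₁)` (polynomial in `a, m, e, ρ⁻¹` times `Z(ρσ³)`). -/
theorem contDiffAt_testedFlux {σ η₁ : ℝ} (hσ : 0 < σ) (hZ : ContDiffOn ℝ 2 hsCompressibility (Set.Ioo 0 η₁))
    {w : (V3 × V3 × (Fin 3 → V3)) × (ℝ × V3 × ℝ)} (h0 : 0 < w.2.1) (h1 : w.2.1 * σ ^ 3 < η₁) :
    ContDiffAt ℝ 2 (fun w : (V3 × V3 × (Fin 3 → V3)) × (ℝ × V3 × ℝ) =>
      (let ρ : ℝ := w.2.1
       let m : V3 := w.2.2.1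
       let e : ℝ := w.2.2.2
       let wb : V3 := ρ⁻¹ • m
       let p : ℝ := ρ * (2 / 3 * (e / ρ - ‖wb‖ ^ 2 / 2)) * hsCompressibility (ρ * σ ^ 3)
       ⟪w.1.1, m⟫_ℝ + (∑ j, (⟪w.1.2.2 j, m⟫_ℝ * wb j + p * w.1.2.2 j j)) + ⟪w.1.2.1, wb⟫_ℝ * (e + p))) w := by
  dsimp only
  have hρ : ContDiffAt ℝ 2 (fun w : (V3 × V3 × (Fin 3 → V3)) × (ℝ × V3 × ℝ) => w.2.1) w := by fun_prop
  have hm : ContDiffAt ℝ 2 (fun w : (V3 × V3 × (Fin 3 → V3)) × (ℝ × V3 × ℝ) => w.2.2.1) w := by fun_prop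
  have he : ContDiffAt ℝ 2 (fun w : (V3 × V3 × (Fin 3 → V3)) × (ℝ × V3 × ℝ) => w.2.2.2) w := by fun_prop
  have ha₀ : ContDiffAt ℝ 2 (fun w : (V3 × V3 × (Fin 3 → V3)) × (ℝ × V3 × ℝ) => w.1.1) w := by fun_prop
  have ha₄ : ContDiffAt ℝ 2 (fun w : (V3 × V3 × (Fin 3 → V3)) × (ℝ × V3 × ℝ) => w.1.2.1) w := by fun_prop
  have ha : ∀ j, ContDiffAt ℝ 2 (fun w : (V3 × V3 × (Fin 3 → V3)) × (ℝ × V3 × ℝ) => w.1.2.2 j) w :=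
    fun j => by fun_prop
  have hajj : ∀ j, ContDiffAt ℝ 2 (fun w : (V3 × V3 × (Fin 3 → V3)) × (ℝ × V3 × ℝ) => w.1.2.2 j j) w :=
    fun j => contDiffAt_euclidean.1 (ha j) j
  have hwb : ContDiffAt ℝ 2 (fun w : (V3 × V3 × (Fin 3 → V3)) × (ℝ × V3 × ℝ) => (w.2.1)⁻¹ • w.2.2.1) w :=
    (hρ.inv h0.ne').smul hm
  have hwbj : ∀ j, ContDiffAt ℝ 2 (fun w : (V3 × V3 × (Fin 3 → V3)) × (ℝ × V3 × ℝ) => ((w.2.1)⁻¹ • w.2.2.1) j) w :=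
    fun j => contDiffAt_euclidean.1 hwb j
  have hZw : ContDiffAt ℝ 2 (fun w : (V3 × V3 × (Fin 3 → V3)) × (ℝ × V3 × ℝ) => hsCompressibility (w.2.1 * σ ^ 3)) w :=
    ContDiffAt.comp (g := hsCompressibility) (f := fun w : (V3 × V3 × (Fin 3 → V3)) × (ℝ × V3 × ℝ) => w.2.1 * σ ^ 3) w
      (hZ.contDiffAt (Ioo_mem_nhds (by positivity) h1)) (hρ.mul contDiffAt_const)
  have hp : ContDiffAt ℝ 2 (fun w : (V3 × V3 × (Fin 3 → V3)) × (ℝ × V3 × ℝ) =>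
      w.2.1 * (2 / 3 * (w.2.2.2 / w.2.1 - ‖(w.2.1)⁻¹ • w.2.2.1‖ ^ 2 / 2)) * hsCompressibility (w.2.1 * σ ^ 3)) w :=
    (hρ.mul (contDiffAt_const.mul ((he.div hρ h0.ne').sub ((hwb.norm_sq ℝ).div_const 2)))).mul hZw
  exact ((ha₀.inner ℝ hm).add (ContDiffAt.sum fun j _ => (((ha j).inner ℝ hm).mul (hwbj j)).add (hp.mul (hajj j)))).add
    ((ha₄.inner ℝ hwb).mul (he.add hp))

/-- **The integrand of `visFluxDensityN` IS the tested capped flux state function** read at the visible block fields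
(definitional bridge to DefsB (e) / toolkit A § 0). -/
theorem visFluxDensityN_eq_testedFlux (σ : ℝ) (ρs : T3 → ℝ) (us : T3 → V3) (A₀ A₄ : T3 → V3) (A : Fin 3 → T3 → V3)
    (R K k : ℝ) (N : ℕ) (y : Config (N + 1) (Fin 3) T3) (x : T3) :
    visFluxDensityN σ ρs us A₀ A₄ A R K k N y x =
      (fun (a₀ a₄ : V3) (a : Fin 3 → V3) (ρc : ℝ) (U : ℝ × V3 × ℝ) =>
        (let ρ : ℝ := U.1
         let m : V3 := U.2.1
         let e : ℝ := U.2.2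
         let wb : V3 := ρ⁻¹ • m
         let p : ℝ := ρ * (2 / 3 * (e / ρ - ‖wb‖ ^ 2 / 2)) * hsCompressibility (min ρ (2 * ρc) * σ ^ 3)
         ⟪a₀, m⟫_ℝ + (∑ j, (⟪a j, m⟫_ℝ * wb j + p * a j j)) + ⟪a₄, wb⟫_ℝ * (e + p)))
        (A₀ x) (A₄ x) (fun j => A j x) (ρs x)
        (visDensityN ρs us R K k N y x, visMomentumN ρs us R K k N y x, visEnergyN ρs us R K k N y x) :=
  rfl

/-- **Second-order Taylor bound of the tested capped Euler flux, uniformly on the parameter box** (plan § 1 (3) D1 of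
stub 4a-ii).  Fix `β, ρmin > 0, ρmax, Ub, Eb, σ > 0, η₁, r` with `(3/2) ρmax σ³ < η₁` and `Z = hsCompressibility` of class
`C²` on `(0, η₁)`.  There is `Cq ≥ 0` such that for all test vectors `‖a₀‖, ‖a₄‖, ‖aⱼ‖ ≤ β`, every Euler state
`Us = (ρs, ρs u, es)` with `ρmin ≤ ρs ≤ ρmax`, `‖u‖ ≤ Ub`, `|es| ≤ Eb`, and every block state `U = (ρ, m, e)` in the box
`|ρ − ρs| ≤ ρs/2`, `‖m − ρs u‖ ≤ r`, `|e − es| ≤ r` (where the EOS cap `min ρ (2ρs)` of `visFluxDensityN` is inactive and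
`0 < ρσ³ < η₁`), the CAPPED tested flux `F` (the integrand of `visFluxDensityN`, `visFluxDensityN_eq_testedFlux`) is
differentiable at `Us` and `|F(U) − F(Us) − DF(Us)(U − Us)| ≤ Cq (|ρ − ρs|² + ‖m − ρs u‖² + |e − es|²)`.  `Cq` depends only on
`(β, ρmin, ρmax, Ub, Eb, σ, η₁, r, Z)`: it is a bound of the second derivative of the uncapped flux on the compact
parameter × state box (`exists_abs_taylor₂_le_of_contDiffOn`, `contDiffAt_testedFlux`). -/
theorem abs_testedFlux_taylor₂_le {β ρmin ρmax Ub Eb σ η₁ r : ℝ} (hρmin : 0 < ρmin) (hσ : 0 < σ)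
    (hη₁ : 3 / 2 * ρmax * σ ^ 3 < η₁) (hZ : ContDiffOn ℝ 2 hsCompressibility (Set.Ioo 0 η₁)) :
    ∃ Cq : ℝ, 0 ≤ Cq ∧ ∀ (a₀ a₄ : V3) (a : Fin 3 → V3) (ρs : ℝ) (u : V3) (es : ℝ) (U : ℝ × V3 × ℝ),
      ‖a₀‖ ≤ β → ‖a₄‖ ≤ β → (∀ j, ‖a j‖ ≤ β) → ρmin ≤ ρs → ρs ≤ ρmax → ‖u‖ ≤ Ub → |es| ≤ Eb →
      |U.1 - ρs| ≤ ρs / 2 → ‖U.2.1 - ρs • u‖ ≤ r → |U.2.2 - es| ≤ r →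
      (let F : ℝ × V3 × ℝ → ℝ := fun W =>
         (let ρ : ℝ := W.1
          let m : V3 := W.2.1
          let e : ℝ := W.2.2
          let wb : V3 := ρ⁻¹ • m
          let p : ℝ := ρ * (2 / 3 * (e / ρ - ‖wb‖ ^ 2 / 2)) * hsCompressibility (min ρ (2 * ρs) * σ ^ 3)
          ⟪a₀, m⟫_ℝ + (∑ j, (⟪a j, m⟫_ℝ * wb j + p * a j j)) + ⟪a₄, wb⟫_ℝ * (e + p))
       let Us : ℝ × V3 × ℝ := (ρs, ρs • u, es)
       DifferentiableAt ℝ F Us ∧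
         |F U - F Us - fderiv ℝ F Us (U - Us)| ≤ Cq * (|U.1 - ρs| ^ 2 + ‖U.2.1 - ρs • u‖ ^ 2 + |U.2.2 - es| ^ 2)) := by
  -- the uncapped joint flux, its smoothness region `O` and the compact parameter × state box `K ⊆ O`
  set Φ : (V3 × V3 × (Fin 3 → V3)) × (ℝ × V3 × ℝ) → ℝ := fun w =>
    (let ρ : ℝ := w.2.1
     let m : V3 := w.2.2.1
     let e : ℝ := w.2.2.2
     let wb : V3 := ρ⁻¹ • m
     let p : ℝ := ρ * (2 / 3 * (e / ρ - ‖wb‖ ^ 2 / 2)) * hsCompressibility (ρ * σ ^ 3)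
     ⟪w.1.1, m⟫_ℝ + (∑ j, (⟪w.1.2.2 j, m⟫_ℝ * wb j + p * w.1.2.2 j j)) + ⟪w.1.2.1, wb⟫_ℝ * (e + p)) with hΦ
  set O : Set ((V3 × V3 × (Fin 3 → V3)) × (ℝ × V3 × ℝ)) := {w | 0 < w.2.1 ∧ w.2.1 * σ ^ 3 < η₁} with hO
  set K : Set ((V3 × V3 × (Fin 3 → V3)) × (ℝ × V3 × ℝ)) :=
    (Metric.closedBall (0 : V3) β ×ˢ Metric.closedBall (0 : V3) β ×ˢ Set.pi Set.univ (fun _ : Fin 3 => Metric.closedBall (0 : V3) β)) ×ˢ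
      (Set.Icc (ρmin / 2) (3 / 2 * ρmax) ×ˢ Metric.closedBall (0 : V3) (ρmax * Ub + r) ×ˢ Metric.closedBall (0 : ℝ) (Eb + r)) with hK
  have hσ3 : 0 < σ ^ 3 := pow_pos hσ 3
  have hOo : IsOpen O :=
    (isOpen_lt continuous_const (continuous_fst.comp continuous_snd)).inter
      (isOpen_lt ((continuous_fst.comp continuous_snd).mul continuous_const) continuous_const)
  have hΦO : ContDiffOn ℝ 2 Φ O := fun w hw => (contDiffAt_testedFlux hσ hZ hw.1 hw.2).contDiffWithinAt
  have hKc : IsCompact K :=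
    ((isCompact_closedBall _ _).prod ((isCompact_closedBall _ _).prod (isCompact_univ_pi fun _ => isCompact_closedBall _ _))).prod
      (isCompact_Icc.prod ((isCompact_closedBall _ _).prod (isCompact_closedBall _ _)))
  have hKO : K ⊆ O := by
    rintro ⟨q, U⟩ ⟨-, hU, -, -⟩
    refine ⟨by linarith [hU.1], ?_⟩
    calc U.1 * σ ^ 3 ≤ 3 / 2 * ρmax * σ ^ 3 := mul_le_mul_of_nonneg_right hU.2 hσ3.le
      _ < η₁ := hη₁
  obtain ⟨M, hM0, hM⟩ := exists_abs_taylor₂_le_of_contDiffOn hOo hΦO hKc hKO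
  refine ⟨M, hM0, ?_⟩
  intro a₀ a₄ a ρs u es U ha₀ ha₄ ha hρ1 hρ2 hu hes hUρ hUm hUe F Us
  have hρs : 0 < ρs := hρmin.trans_le hρ1
  have hr : 0 ≤ r := (norm_nonneg _).trans hUm
  -- the box around `Us` is convex and sits in the `K`-fibre of the parameters
  set B : Set (ℝ × V3 × ℝ) := Set.Icc (ρs / 2) (3 / 2 * ρs) ×ˢ Metric.closedBall (ρs • u) r ×ˢ Metric.closedBall es r
    with hB
  have hBc : Convex ℝ B := (convex_Icc _ _).prod ((convex_closedBall _ _).prod (convex_closedBall _ _))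
  have hUB : U ∈ B := by
    refine ⟨?_, mem_closedBall_iff_norm.2 hUm, ?_⟩
    · constructor <;> linarith [(abs_sub_le_iff.1 hUρ).1, (abs_sub_le_iff.1 hUρ).2]
    · rw [Metric.mem_closedBall, Real.dist_eq]; exact hUe
  have hUsB : Us ∈ B := by
    refine ⟨⟨by linarith, by linarith⟩, Metric.mem_closedBall_self hr, Metric.mem_closedBall_self hr⟩
  have hBK : ∀ z ∈ B, (((a₀, a₄, a), z) : (V3 × V3 × (Fin 3 → V3)) × (ℝ × V3 × ℝ)) ∈ K := by
    rintro z ⟨hz1, hz2, hz3⟩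
    refine ⟨⟨mem_closedBall_zero_iff.2 ha₀, mem_closedBall_zero_iff.2 ha₄, Set.mem_univ_pi.2 fun j =>
      mem_closedBall_zero_iff.2 (ha j)⟩, ⟨⟨by linarith [hz1.1], by linarith [hz1.2]⟩, ?_, ?_⟩⟩
    · rw [mem_closedBall_zero_iff]
      have h1 : ‖z.2.1 - ρs • u‖ ≤ r := mem_closedBall_iff_norm.1 hz2
      have h2 : ‖ρs • u‖ ≤ ρmax * Ub := by
        rw [norm_smul, Real.norm_eq_abs, abs_of_pos hρs]
        exact mul_le_mul hρ2 hu (norm_nonneg _) (hρs.le.trans hρ2)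
      calc ‖z.2.1‖ = ‖(z.2.1 - ρs • u) + ρs • u‖ := by rw [sub_add_cancel]
        _ ≤ ‖z.2.1 - ρs • u‖ + ‖ρs • u‖ := norm_add_le _ _
        _ ≤ ρmax * Ub + r := by linarith
    · rw [mem_closedBall_zero_iff, Real.norm_eq_abs]
      have h1 : |z.2.2 - es| ≤ r := by rw [← Real.dist_eq]; exact hz3
      calc |z.2.2| = |(z.2.2 - es) + es| := by rw [sub_add_cancel]
        _ ≤ |z.2.2 - es| + |es| := abs_add_le _ _
        _ ≤ Eb + r := by linarith
  have hseg : ∀ z ∈ segment ℝ Us U, (((a₀, a₄, a), z) : (V3 × V3 × (Fin 3 → V3)) × (ℝ × V3 × ℝ)) ∈ K :=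
    fun z hz => hBK z (hBc.segment_subset hUsB hUB hz)
  -- the cap is inactive near `Us` and on the box: `F = Φ((a₀, a₄, a), ·)` there
  have hcap : ∀ z : ℝ × V3 × ℝ, z.1 ≤ 2 * ρs → F z = Φ ((a₀, a₄, a), z) := by
    intro z hz
    simp only [F, hΦ, min_eq_left hz]
  have hev : F =ᶠ[𝓝 Us] fun z => Φ ((a₀, a₄, a), z) := by
    have hUs1 : Us.1 < 2 * ρs := by show ρs < 2 * ρs; linarith
    filter_upwards [(isOpen_lt continuous_fst continuous_const).mem_nhds hUs1] with z hz
    exact hcap z (le_of_lt hz)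
  have hUsO : (((a₀, a₄, a), Us) : (V3 × V3 × (Fin 3 → V3)) × (ℝ × V3 × ℝ)) ∈ O := hKO (hBK Us hUsB)
  have hdiff : DifferentiableAt ℝ (fun z => Φ ((a₀, a₄, a), z)) Us :=
    (((contDiffAt_testedFlux hσ hZ hUsO.1 hUsO.2).differentiableAt (by norm_num)).comp Us
      ((differentiableAt_const _).prodMk differentiableAt_id))
  refine ⟨hdiff.congr_of_eventuallyEq hev, ?_⟩
  have hmain := hM (a₀, a₄, a) Us U hseg
  have hU1 : U.1 ≤ 2 * ρs := by linarith [(abs_sub_le_iff.1 hUρ).1]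
  rw [hcap U hU1, hcap Us (by show ρs ≤ 2 * ρs; linarith), hev.fderiv_eq]
  refine hmain.trans (mul_le_mul_of_nonneg_left ?_ hM0)
  -- `‖U − Us‖² ≤ |δρ|² + ‖δm‖² + |δe|²` for the sup norm of the product
  have h1 : ‖U - Us‖ = max |U.1 - ρs| (max ‖U.2.1 - ρs • u‖ |U.2.2 - es|) := by
    simp only [Us, Prod.norm_def, Prod.fst_sub, Prod.snd_sub, Real.norm_eq_abs]
  rw [h1]
  have hA := abs_nonneg (U.1 - ρs)
  have hBn := norm_nonneg (U.2.1 - ρs • u)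
  have hC := abs_nonneg (U.2.2 - es)
  rcases max_choice |U.1 - ρs| (max ‖U.2.1 - ρs • u‖ |U.2.2 - es|) with h | h <;> rw [h]
  · nlinarith
  · rcases max_choice ‖U.2.1 - ρs • u‖ |U.2.2 - es| with h' | h' <;> rw [h'] <;> nlinarith

end Flux

/-! ## The registered helper stub -/

/-- **Registered helper stub `stub_windowClauseQuadRemainder` (plan § 1 (3) D1 of stub 4a-ii, skeleton v8, crux stmt-17740)**:
sorry-free conjunction of § 1 (`norm_sub_sub_le_of_norm_fderiv_sub_le`, `exists_abs_taylor₂_le_of_contDiffOn`) and § 2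
(`contDiffAt_testedFlux`, `abs_testedFlux_taylor₂_le`), restated with fully qualified names (the registered one-line
signature; the definitional bridge `visFluxDensityN_eq_testedFlux` is `rfl` and stays outside the conjunction). -/
theorem stub_windowClauseQuadRemainder : (∀ {E G : Type*} [NormedAddCommGroup E] [NormedSpace ℝ E] [NormedAddCommGroup G] [NormedSpace ℝ G] {f : E → G} {f' : E → E →L[ℝ] G} {s : Set E} {x : E} {C : ℝ}, Convex ℝ s → x ∈ s → (∀ y ∈ s, HasFDerivWithinAt f (f' y) s y) → (∀ y ∈ s, ‖f' y - f' x‖ ≤ C * ‖y - x‖) → ∀ {y : E}, y ∈ s → ‖f y - f x - f' x (y - x)‖ ≤ C * ‖y - x‖ ^ 2) ∧ (∀ {E P : Type*} [NormedAddCommGroup E] [NormedSpace ℝ E] [NormedAddCommGroup P] [NormedSpace ℝ P] {Φ : P × E → ℝ} {O K : Set (P × E)}, IsOpen O → ContDiffOn ℝ 2 Φ O → IsCompact K → K ⊆ O → ∃ M : ℝ, 0 ≤ M ∧ ∀ (p : P) (x y : E), (∀ z ∈ segment ℝ x y, (p, z) ∈ K) → |Φ (p, y) - Φ (p, x) - fderiv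 ℝ (fun z => Φ (p, z)) x (y - x)| ≤ M * ‖y - x‖ ^ 2) ∧ (∀ {σ η₁ : ℝ}, 0 < σ → ContDiffOn ℝ 2 Literature.MathematicalPhysics.KineticTheory.hsCompressibility (Set.Ioo 0 η₁) → ∀ {w : (Literature.MathematicalPhysics.KineticTheory.V3 × Literature.MathematicalPhysics.KineticTheory.V3 × (Fin 3 → Literature.MathematicalPhysics.KineticTheory.V3)) × (ℝ × Literature.MathematicalPhysics.KineticTheory.V3 × ℝ)}, 0 < w.2.1 → w.2.1 * σ ^ 3 < η₁ → ContDiffAt ℝ 2 (fun w : (Literature.MathematicalPhysics.KineticTheory.V3 × Literature.MathematicalPhysics.KineticTheory.V3 × (Fin 3 → Literature.MathematicalPhysics.KineticTheory.V3)) × (ℝ × Literature.MathematicalPhysics.KineticTheory.V3 × ℝ) => (let ρ : ℝ := w.2.1; let m : Literature.MathematicalPhysics.KineticTheory.V3 := w.2.2.1; let e : ℝ := w.2.2.2; let wb : Literature.MathematicalPhysics.KineticTheory.V3 := ρ⁻¹ • m; let p : ℝ := ρ * (2 / 3 * (e / ρ - ‖wb‖ ^ 2 / 2)) * Literature.MathematicalPhysics.KineticTheory.hsCompressibility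 (ρ * σ ^ 3); inner ℝ w.1.1 m + (∑ j, (inner ℝ (w.1.2.2 j) m * wb j + p * w.1.2.2 j j)) + inner ℝ w.1.2.1 wb * (e + p))) w) ∧ (∀ {β ρmin ρmax Ub Eb σ η₁ r : ℝ}, 0 < ρmin → 0 < σ → 3 / 2 * ρmax * σ ^ 3 < η₁ → ContDiffOn ℝ 2 Literature.MathematicalPhysics.KineticTheory.hsCompressibility (Set.Ioo 0 η₁) → ∃ Cq : ℝ, 0 ≤ Cq ∧ ∀ (a₀ a₄ : Literature.MathematicalPhysics.KineticTheory.V3) (a : Fin 3 → Literature.MathematicalPhysics.KineticTheory.V3) (ρs : ℝ) (u : Literature.MathematicalPhysics.KineticTheory.V3) (es : ℝ) (U : ℝ × Literature.MathematicalPhysics.KineticTheory.V3 × ℝ), ‖a₀‖ ≤ β → ‖a₄‖ ≤ β → (∀ j, ‖a j‖ ≤ β) → ρmin ≤ ρs → ρs ≤ ρmax → ‖u‖ ≤ Ub → |es| ≤ Eb → |U.1 - ρs| ≤ ρs / 2 → ‖U.2.1 - ρs • u‖ ≤ r → |U.2.2 - es| ≤ r → (let F : ℝ × Literature.MathematicalPhysics.KineticTheory.V3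 × ℝ → ℝ := fun W => (let ρ : ℝ := W.1; let m : Literature.MathematicalPhysics.KineticTheory.V3 := W.2.1; let e : ℝ := W.2.2; let wb : Literature.MathematicalPhysics.KineticTheory.V3 := ρ⁻¹ • m; let p : ℝ := ρ * (2 / 3 * (e / ρ - ‖wb‖ ^ 2 / 2)) * Literature.MathematicalPhysics.KineticTheory.hsCompressibility (min ρ (2 * ρs) * σ ^ 3); inner ℝ a₀ m + (∑ j, (inner ℝ (a j) m * wb j + p * a j j)) + inner ℝ a₄ wb * (e + p)); let Us : ℝ × Literature.MathematicalPhysics.KineticTheory.V3 × ℝ := (ρs, ρs • u, es); DifferentiableAt ℝ F Us ∧ |F U - F Us - fderiv ℝ F Us (U - Us)| ≤ Cq * (|U.1 - ρs| ^ 2 + ‖U.2.1 - ρs • u‖ ^ 2 + |U.2.2 - es| ^ 2))) :=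
  ⟨fun hs hx hf hC _ hy => norm_sub_sub_le_of_norm_fderiv_sub_le hs hx hf hC hy,
    fun hO hΦ hK hKO => exists_abs_taylor₂_le_of_contDiffOn hO hΦ hK hKO,
    fun hσ hZ _ h0 h1 => contDiffAt_testedFlux hσ hZ h0 h1,
    fun hρmin hσ hη₁ hZ => abs_testedFlux_taylor₂_le hρmin hσ hη₁ hZ⟩

end Summit.AtomisticToContinuum.HydrodynamicLimit.Theorems.LTEInBand

end
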